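import Literature.AlgebraicGeometry.Motives.UnitaryPeriodDomainUpperHalfSpaceEquivariance
import HarnessLib

/-!
# `ι : SU(J) → SU(n, n)`, `M ↦ l̄ M l̄⁻¹`, is an ISOMORPHISM `SU(J) ≃* SU(n, n)`;
# the Cayley bijection `H(n; ℂ) ≅ I_{n,n}` is `SU(n, n)`-equivariant in both directions

Layer `Literature/AlgebraicGeometry/Motives`, namespace `Literature.AlgebraicGeometry.Motives`; lane `lit-hodgefound`
(Track 2 foundations library), Layer A (the period domain `I_{p,q}` of abelian varieties of Weil type; prover seat p13,
generation 15, self-proposed row g15-#6).  Closes the item listed under "NOT here" in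
`Motives/UnitaryPeriodDomainUpperHalfSpaceEquivariance` ("surjectivity of `ι : SU(J) → SU(n, n)` (it is an isomorphism;
only injectivity is proved)").  Sequel BY NAME of that file (`conjCayleyMat`, `blockSwap`, `hermCayleyConj`,
`hermitianSpecialSymplecticGroup`, `hermCayleyToUnitary`, `stdMat_hermCayleyToUnitary`, `hermCayleyToUnitary_injective`,
`conjTranspose_blockSwap`, `blockSwap_mul_sigMatrix_mul_blockSwap`, `inv_conjCayleyMat`, `conjCayleyMat_eq`,
`isUnit_det_conjCayleyMat`, `hermitianHalfSpaceEquiv_smul`, `hermitianHalfSpaceEquiv_symm_smul`,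
`hermCayleyToUnitary_smul_zeroPoint`, `hermitianHalfSpace.exists_special_smul_eq`, `smul_I_smul_one_eq_iff`), of
`Motives/UnitaryPeriodDomainUpperHalfSpace` (`hermitianHalfSpaceEquiv`, `hermitianHalfSpaceEquiv_I_smul_one`,
`mem_hermitianSymplecticGroup_iff`), of `Motives/UnitaryPeriodDomainPolarDecomposition` (`stdMat`,
`conjTranspose_stdMat_mul`, `det_stdMat_eq_one`) and of the tree's second transport identity
`SiegelDiscAction.conjTranspose_invConj_mul_J_mul_invConj` (`(l⁻¹ml)ᴴ J (l⁻¹ml) = −(i/2)·lᴴ(mᴴkm)l`) with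
`conjTranspose_cayleyMat_mul_k_mul` (`lᴴ k l = 2i·J`).  Definitions with bodies (`hermCayleyConjInv`, `hermCayleyMulEquiv`)
and PROVED theorems; no named fact, no `sorry` (net debt 0).

## Sources

H. Klingen, *Introductory Lectures on Siegel Modular Forms* (CUP 1990) [Klingen1990], §1 (4): "`Φ_n = l Sp(n,ℝ) l⁻¹ =
{m ∈ GL(2n,ℂ) | m = (a b; b̄ ā), k{m} = k}`" — an EQUALITY of groups, proved in the book by transporting the forms in
both directions ("`j{m} = j ⟺ j{l⁻¹}{m*} = j{l⁻¹} ⟺ k{m*} = k`"); the tree formalises both transport identities for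
arbitrary complex matrices (`SiegelDiscAction`, §FormulaFour), and the present file uses the second one for the complex
group `SU(J)`.  A. Krieg, Pacific J. Math. 133 (1988) [Krieg1988HalfSpaces], §1: the generalized Cayley transformation
`ℋ(n;𝔽) → 𝒟(n;𝔽)` "bijective and inverse to each other", Thm. 1.3 (transitivity), Prop. 1.6 (`Stab(I) = MSp(n;𝔽) ∩
𝒰(2n;𝔽)`).  A. Krieg, LNM 1143 [Krieg1985QuaternionHalfSpaces], Ch. II §1 Lemma 1.1 ("`Sp(n;𝔽)` is a subgroup of
`GL(2n;𝔽)`"; fundamental relations).  B. van Geemen, LNM 1594 [vanGeemen1994HodgeAV], 5.8 (`SU(n,n)`, `det = 1`),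
5.10 Lemma (transitivity, stabilizer `S(U(n) × U(n))`).

## What is defined and proved

* §1 **`hermCayleyConjInv G = l̄⁻¹ G l̄ = l⁻¹ (SGS) l`**, two-sided inverse of `hermCayleyConj`, `det`-preserving, and
  **`conjTranspose_hermCayleyConjInv_mul_J_mul`**: `Ḡᵗ k G = k ⟹ (l̄⁻¹Gl̄)̄ᵗ J (l̄⁻¹Gl̄) = J`; hence
  `hermCayleyConjInv_stdMat_mem : l̄⁻¹ (stdMat g) l̄ ∈ SU(J)` for `g ∈ SU(n, n)`.
* §2 `hermCayleyToUnitary_hermCayleyConjInv` (`ι(l̄⁻¹ (stdMat g) l̄) = g`), **`hermCayleyToUnitary_surjective`**,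
  `hermCayleyToUnitary_bijective`, **`hermCayleyMulEquiv n : hermitianSpecialSymplecticGroup n ≃* stdSpecialUnitaryGroup n n`**
  (`= ι` on elements; inverse on matrices `coe_hermCayleyMulEquiv_symm`), and `hermitianSpecialSymplecticGroup.isUnit`
  (every element of the submonoid `SU(J)` is a unit).
* §3 **`hermitianHalfSpaceEquiv_symm_smul'`** (`c⁻¹(g • P) = ι⁻¹(g) • c⁻¹(P)` for ALL `g ∈ SU(n, n)`),
  `hermitianHalfSpaceEquiv_symm_mulEquiv_smul` (`c(ι⁻¹(g) • Z) = g • c(Z)`), `exists_smul_zeroPoint_eq_of_hermitian`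
  (transitivity of `SU(n, n)` on `I_{n,n}` transported from Krieg's Thm. 1.3), `smul_zeroPoint_eq_iff_symm_smul_I` and
  `smul_zeroPoint_eq_iff_hermCayleyConjInv_unitary` (isotropy correspondence `Stab(0) ↔ Stab(i1) = SU(J) ∩ U(2n)`).
* §4 `exists_hermCayley_mulEquiv` (packaged statement).

NOT here: the full unitary groups `U(J) ≅ U(n, n)` (determinants of modulus one; the lane's groups are special unitary);
topology/holomorphy of `ι` and `c`.  The Hodge conjecture is not addressed.
-/

noncomputable section

open Matrix Complex
open scoped ComplexOrder MatrixOrder ComplexConjugate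

namespace Literature.AlgebraicGeometry.Motives

open Literature.NumberTheory.ModularForms.SiegelUpperHalfSpace (moeb cayleyMat isUnit_det_cayleyMat
  conjTranspose_invConj_mul_J_mul_invConj conjTranspose_cayleyMat_mul_k_mul)

variable {n : ℕ}

local notation "Vn" => EuclideanSpace ℂ (Fin n)
local notation "Vnn" => EuclideanSpace ℂ (Fin n) × EuclideanSpace ℂ (Fin n)
local notation "𝕄" => Matrix (Fin n ⊕ Fin n) (Fin n ⊕ Fin n) ℂ

/-! ## §1 The inverse conjugation `G ↦ l̄⁻¹ G l̄ = l⁻¹ (S G S) l` -/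

section Inverse

/-- **The inverse conjugation `G ↦ l̄⁻¹ G l̄`** (from the lane's diagonal form `k = diag(1, −1)` back to Krieg's `J`).
[cite: Klingen1990, §1 (4) ("`m ↦ l⁻¹ m l`")] [cite: Krieg1988HalfSpaces, §1 (the Cayley transformation)] -/
def hermCayleyConjInv (G : 𝕄) : 𝕄 := (conjCayleyMat n)⁻¹ * G * conjCayleyMat n

/-- `l̄⁻¹ G l̄ = l⁻¹ (S G S) l`. [cite: Klingen1990, §1 (4)] -/
theorem hermCayleyConjInv_eq (G : 𝕄) :
    hermCayleyConjInv G = (cayleyMat (Fin n))⁻¹ * (blockSwap n * G * blockSwap n) * cayleyMat (Fin n) := by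
  rw [hermCayleyConjInv, inv_conjCayleyMat, conjCayleyMat_eq]
  simp only [Matrix.mul_assoc]

/-- `l̄ (l̄⁻¹ G l̄) l̄⁻¹ = G`. [cite: Klingen1990, §1 (4)] -/
theorem hermCayleyConj_hermCayleyConjInv (G : 𝕄) : hermCayleyConj (hermCayleyConjInv G) = G := by
  rw [hermCayleyConj, hermCayleyConjInv]
  simp only [Matrix.mul_assoc, mul_nonsing_inv_cancel_left _ _ isUnit_det_conjCayleyMat,
    mul_nonsing_inv _ isUnit_det_conjCayleyMat, Matrix.mul_one]

/-- `l̄⁻¹ (l̄ M l̄⁻¹) l̄ = M`. [cite: Klingen1990, §1 (4)] -/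
theorem hermCayleyConjInv_hermCayleyConj (M : 𝕄) : hermCayleyConjInv (hermCayleyConj M) = M := by
  rw [hermCayleyConj, hermCayleyConjInv]
  simp only [Matrix.mul_assoc, nonsing_inv_mul_cancel_left _ _ isUnit_det_conjCayleyMat,
    nonsing_inv_mul _ isUnit_det_conjCayleyMat, Matrix.mul_one]

/-- `det (l̄⁻¹ G l̄) = det G`. [cite: Klingen1990, §1 (4)] -/
theorem det_hermCayleyConjInv (G : 𝕄) : (hermCayleyConjInv G).det = G.det :=
  Matrix.det_conj' ((Matrix.isUnit_iff_isUnit_det _).2 isUnit_det_conjCayleyMat) G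

/-- **Transport of the forms, converse direction: `Ḡᵗ k G = k ⟹ (l̄⁻¹Gl̄)̄ᵗ J (l̄⁻¹Gl̄) = J`** — from the tree's second
transport identity `(l⁻¹ml)ᴴ J (l⁻¹ml) = −(i/2)·lᴴ(mᴴkm)l` (for `m = SGS`, `mᴴkm = −S(ᴴGkG)S = k`) and `lᴴ k l = 2i·J`.
[cite: Klingen1990, §1 (4) ("`j{m} = j ⟺ k{m*} = k`")] [cite: Krieg1985QuaternionHalfSpaces, Ch. II §1 Lemma 1.1] -/
theorem conjTranspose_hermCayleyConjInv_mul_J_mul {G : 𝕄} (hG : Gᴴ * sigMatrix n n * G = sigMatrix n n) :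
    (hermCayleyConjInv G)ᴴ * Matrix.J (Fin n) ℂ * hermCayleyConjInv G = Matrix.J (Fin n) ℂ := by
  have hk : (Matrix.fromBlocks 1 0 0 (-1) : 𝕄) = sigMatrix n n := rfl
  have hm : (blockSwap n * G * blockSwap n)ᴴ * sigMatrix n n * (blockSwap n * G * blockSwap n) = sigMatrix n n := by
    rw [conjTranspose_mul, conjTranspose_mul, conjTranspose_blockSwap]
    calc blockSwap n * (Gᴴ * blockSwap n) * sigMatrix n n * (blockSwap n * G * blockSwap n)
        = blockSwap n * (Gᴴ * (blockSwap n * sigMatrix n n * blockSwap n) * G) * blockSwap n := by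
          simp only [Matrix.mul_assoc]
      _ = sigMatrix n n := by
          rw [blockSwap_mul_sigMatrix_mul_blockSwap, Matrix.mul_neg, Matrix.neg_mul, hG, Matrix.mul_neg, Matrix.neg_mul,
            blockSwap_mul_sigMatrix_mul_blockSwap, neg_neg]
  rw [hermCayleyConjInv_eq, conjTranspose_invConj_mul_J_mul_invConj, hk, hm, ← hk, conjTranspose_cayleyMat_mul_k_mul,
    smul_smul, show (-(I / 2) * (2 * I) : ℂ) = 1 by
      rw [neg_mul, div_mul_eq_mul_div, ← mul_assoc, mul_comm I 2, mul_assoc, I_mul_I]; norm_num, one_smul]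

/-- For `g ∈ SU(n, n)`: `l̄⁻¹ (stdMat g) l̄ ∈ SU(J)`. [cite: Klingen1990, §1 (4)] [cite: vanGeemen1994HodgeAV, 5.8] -/
theorem hermCayleyConjInv_stdMat_mem (g : stdSpecialUnitaryGroup n n) :
    hermCayleyConjInv (stdMat (g : Vnn ≃ₗ[ℂ] Vnn)) ∈ hermitianSpecialSymplecticGroup n := by
  refine ⟨mem_hermitianSymplecticGroup_iff.2 (conjTranspose_hermCayleyConjInv_mul_J_mul (conjTranspose_stdMat_mul g)), ?_⟩
  rw [det_hermCayleyConjInv, det_stdMat_eq_one]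

end Inverse

/-! ## §2 `ι` is a bijection: the isomorphism `SU(J) ≃* SU(n, n)` -/

section Iso

/-- `stdMat` is injective. [folklore] -/
private theorem stdMat_inj'' {A B : Vnn ≃ₗ[ℂ] Vnn} (h : stdMat A = stdMat B) : A = B :=
  LinearEquiv.toLinearMap_injective ((LinearMap.toMatrix _ _).injective h)

/-- **`ι` is surjective**: `g = ι(l̄⁻¹ (stdMat g) l̄)`. [cite: Klingen1990, §1 (4) (`Φ_n = l Sp(n,ℝ) l⁻¹` is an equality)]
[cite: Krieg1988HalfSpaces, §1 (Cayley transformation)] -/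
theorem hermCayleyToUnitary_hermCayleyConjInv (g : stdSpecialUnitaryGroup n n) :
    hermCayleyToUnitary ⟨hermCayleyConjInv (stdMat (g : Vnn ≃ₗ[ℂ] Vnn)), hermCayleyConjInv_stdMat_mem g⟩ = g := by
  refine Subtype.ext (stdMat_inj'' ?_)
  rw [stdMat_hermCayleyToUnitary]
  exact hermCayleyConj_hermCayleyConjInv _

/-- **`ι : SU(J) → SU(n, n)` is surjective.** [cite: Klingen1990, §1 (4)] [cite: Krieg1988HalfSpaces, §1] -/
theorem hermCayleyToUnitary_surjective :
    Function.Surjective (hermCayleyToUnitary : hermitianSpecialSymplecticGroup n → stdSpecialUnitaryGroup n n) :=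
  fun g => ⟨_, hermCayleyToUnitary_hermCayleyConjInv g⟩

/-- **`ι` is bijective.** [cite: Klingen1990, §1 (4)] [cite: Krieg1988HalfSpaces, §1] -/
theorem hermCayleyToUnitary_bijective :
    Function.Bijective (hermCayleyToUnitary : hermitianSpecialSymplecticGroup n → stdSpecialUnitaryGroup n n) :=
  ⟨hermCayleyToUnitary_injective, hermCayleyToUnitary_surjective⟩

variable (n) in
/-- **The isomorphism `ι : SU(J) ≃* SU(n, n)`** (Krieg's `Sp(n; ℂ) ∩ SL` in the `J`-form and the lane's `SU(n, n)` in the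
diagonal form are conjugate by the Cayley matrix `l̄`). [cite: Klingen1990, §1 (4)] [cite: Krieg1988HalfSpaces, §1 (Cayley transformation), Prop. 1.6]
[cite: vanGeemen1994HodgeAV, 5.8, 5.10] -/
def hermCayleyMulEquiv : hermitianSpecialSymplecticGroup n ≃* stdSpecialUnitaryGroup n n :=
  MulEquiv.ofBijective (hermCayleyToUnitary : hermitianSpecialSymplecticGroup n →* stdSpecialUnitaryGroup n n)
    hermCayleyToUnitary_bijective

/-- `hermCayleyMulEquiv = ι` on elements. [cite: Klingen1990, §1 (4)] -/
@[simp] theorem hermCayleyMulEquiv_apply (M : hermitianSpecialSymplecticGroup n) :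
    hermCayleyMulEquiv n M = hermCayleyToUnitary M := rfl

/-- The inverse on matrices: `(ι⁻¹ g) = l̄⁻¹ (stdMat g) l̄`. [cite: Klingen1990, §1 (4)] -/
theorem coe_hermCayleyMulEquiv_symm (g : stdSpecialUnitaryGroup n n) :
    (((hermCayleyMulEquiv n).symm g : hermitianSpecialSymplecticGroup n) : 𝕄) =
      hermCayleyConjInv (stdMat (g : Vnn ≃ₗ[ℂ] Vnn)) := by
  have h : (hermCayleyMulEquiv n).symm g = ⟨hermCayleyConjInv (stdMat (g : Vnn ≃ₗ[ℂ] Vnn)), hermCayleyConjInv_stdMat_mem g⟩ :=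
    (hermCayleyMulEquiv n).injective (by rw [MulEquiv.apply_symm_apply, hermCayleyMulEquiv_apply,
      hermCayleyToUnitary_hermCayleyConjInv])
  rw [h]

/-- `SU(J)` is a group: every element is invertible inside the submonoid (inverse `ι⁻¹(ι(M)⁻¹)`).
[cite: Krieg1985QuaternionHalfSpaces, Ch. II §1 Lemma 1.1 ("`Sp(n;𝔽)` is a subgroup of `GL(2n;𝔽)`")] -/
theorem hermitianSpecialSymplecticGroup.isUnit (M : hermitianSpecialSymplecticGroup n) : IsUnit M :=
  (MulEquiv.isUnit_map (hermCayleyMulEquiv n)).1 (Group.isUnit _)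

end Iso

/-! ## §3 Equivariance for the whole `SU(n, n)`: `c⁻¹(g • P) = ι⁻¹(g) • c⁻¹(P)` -/

section Equivariance

/-- **Equivariance of the inverse Cayley map under ALL of `SU(n, n)`**: for `g ∈ SU(n, n)` and `P ∈ I_{n,n}`,
`(hermitianHalfSpaceEquiv n).symm (g • P) = ι⁻¹(g) • (hermitianHalfSpaceEquiv n).symm P`.
[cite: Krieg1988HalfSpaces, §1 (Cayley transformation), Thm. 1.3] [cite: Klingen1990, §1 Prop. 2] -/
theorem hermitianHalfSpaceEquiv_symm_smul' (g : stdSpecialUnitaryGroup n n) (P : unitaryPeriodDomain n n) :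
    (hermitianHalfSpaceEquiv n).symm (g • P) = (hermCayleyMulEquiv n).symm g • (hermitianHalfSpaceEquiv n).symm P := by
  conv_lhs => rw [← (hermCayleyMulEquiv n).apply_symm_apply g, hermCayleyMulEquiv_apply]
  exact hermitianHalfSpaceEquiv_symm_smul _ P

/-- **Equivariance, forward, for ALL of `SU(n, n)`**: `hermitianHalfSpaceEquiv n (ι⁻¹(g) • Z) = g • hermitianHalfSpaceEquiv n Z`.
[cite: Krieg1988HalfSpaces, §1] [cite: Klingen1990, §1 Prop. 2] -/
theorem hermitianHalfSpaceEquiv_symm_mulEquiv_smul (g : stdSpecialUnitaryGroup n n) (Z : hermitianHalfSpace n) :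
    hermitianHalfSpaceEquiv n ((hermCayleyMulEquiv n).symm g • Z) = g • hermitianHalfSpaceEquiv n Z := by
  conv_rhs => rw [← (hermCayleyMulEquiv n).apply_symm_apply g, hermCayleyMulEquiv_apply]
  exact hermitianHalfSpaceEquiv_smul _ Z

/-- **Transitivity of `SU(n, n)` on `I_{n,n}` re-derived from Krieg's transitivity on `H(n; ℂ)`** (the lane proves it
independently in `Motives/UnitaryPeriodDomainHomogeneous`; here it is transported along `c`).
[cite: Krieg1988HalfSpaces, §1 Thm. 1.3] [cite: vanGeemen1994HodgeAV, 5.10 Lemma] -/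
theorem exists_smul_zeroPoint_eq_of_hermitian (P : unitaryPeriodDomain n n) :
    ∃ g : stdSpecialUnitaryGroup n n, g • zeroPoint n n = P := by
  obtain ⟨M, hM⟩ := hermitianHalfSpace.exists_special_smul_eq ((hermitianHalfSpaceEquiv n).symm P)
  refine ⟨hermCayleyToUnitary M, ?_⟩
  rw [hermCayleyToUnitary_smul_zeroPoint, hM, Equiv.apply_symm_apply]

/-- **Isotropy correspondence**: `g ∈ SU(n, n)` fixes `0 ∈ I_{n,n}` iff `ι⁻¹(g)` fixes `i1 ∈ H(n; ℂ)` iff the matrix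
`l̄⁻¹ (stdMat g) l̄` is unitary (`Stab(0) = K ↔ Stab(i1) = SU(J) ∩ U(2n)`).
[cite: Krieg1988HalfSpaces, §1 Prop. 1.6] [cite: vanGeemen1994HodgeAV, 5.10 Lemma (`S(U(n) × U(n))`)] -/
theorem smul_zeroPoint_eq_iff_symm_smul_I (g : stdSpecialUnitaryGroup n n) :
    g • zeroPoint n n = zeroPoint n n ↔
      (hermCayleyMulEquiv n).symm g • (⟨I • 1, I_smul_one_mem_hermitianHalfSpace⟩ : hermitianHalfSpace n) =
        ⟨I • 1, I_smul_one_mem_hermitianHalfSpace⟩ := by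
  rw [← (hermitianHalfSpaceEquiv n).injective.eq_iff, hermitianHalfSpaceEquiv_symm_mulEquiv_smul,
    hermitianHalfSpaceEquiv_I_smul_one]

/-- The same with Krieg's unitarity criterion: `g • 0 = 0 ↔ (l̄⁻¹ (stdMat g) l̄)̄ᵗ (l̄⁻¹ (stdMat g) l̄) = 1`.
[cite: Krieg1988HalfSpaces, §1 Prop. 1.6 ("`Stab(I) = MSp(n;𝔽) ∩ 𝒰(2n;𝔽)`")] -/
theorem smul_zeroPoint_eq_iff_hermCayleyConjInv_unitary (g : stdSpecialUnitaryGroup n n) :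
    g • zeroPoint n n = zeroPoint n n ↔
      (hermCayleyConjInv (stdMat (g : Vnn ≃ₗ[ℂ] Vnn)))ᴴ * hermCayleyConjInv (stdMat (g : Vnn ≃ₗ[ℂ] Vnn)) = 1 := by
  rw [smul_zeroPoint_eq_iff_symm_smul_I, smul_I_smul_one_eq_iff, coe_hermCayleyMulEquiv_symm]

end Equivariance

/-! ## §4 Summary -/

section Summary

/-- **Summary:** `ι : SU(J) ≃* SU(n, n)` is a multiplicative isomorphism extending `Sp(2n, ℝ) → SU(n, n)`, and the Cayley
bijection `H(n; ℂ) ≃ I_{n,n}` is equivariant for it in both directions; in particular `SU(n, n)` is transitive on `I_{n,n}`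
and the isotropy groups of `i1` and `0` correspond. [cite: Krieg1988HalfSpaces, §1 Thm. 1.3, Prop. 1.6, Cayley transformation]
[cite: Klingen1990, §1 (4), Prop. 2] [cite: vanGeemen1994HodgeAV, 5.10 Lemma] -/
theorem exists_hermCayley_mulEquiv :
    ∃ ι : hermitianSpecialSymplecticGroup n ≃* stdSpecialUnitaryGroup n n,
      (∀ M, ι M = hermCayleyToUnitary M) ∧
      (∀ (M : hermitianSpecialSymplecticGroup n) (Z : hermitianHalfSpace n),
        hermitianHalfSpaceEquiv n (M • Z) = ι M • hermitianHalfSpaceEquiv n Z) ∧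
      (∀ (g : stdSpecialUnitaryGroup n n) (P : unitaryPeriodDomain n n),
        (hermitianHalfSpaceEquiv n).symm (g • P) = ι.symm g • (hermitianHalfSpaceEquiv n).symm P) ∧
      (∀ P : unitaryPeriodDomain n n, ∃ g : stdSpecialUnitaryGroup n n, g • zeroPoint n n = P) ∧
      (∀ g : stdSpecialUnitaryGroup n n, g • zeroPoint n n = zeroPoint n n ↔
        ι.symm g • (⟨I • 1, I_smul_one_mem_hermitianHalfSpace⟩ : hermitianHalfSpace n) =
          ⟨I • 1, I_smul_one_mem_hermitianHalfSpace⟩) :=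
  ⟨hermCayleyMulEquiv n, fun _ => rfl, hermitianHalfSpaceEquiv_smul, hermitianHalfSpaceEquiv_symm_smul',
    exists_smul_zeroPoint_eq_of_hermitian, smul_zeroPoint_eq_iff_symm_smul_I⟩

end Summary

end Literature.AlgebraicGeometry.Motives

end
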